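import Mathlib
import HarnessLib
import Summits.HubbardSuperconductivity.HubbardSuperconductivity.Theorems.KLProgrammeKLRegimeEngineV8DefsG10

/-!
# Route `KLProgramme` — ENGINE child gen 8 (stmt-HubbardSuperconductivity-20437 `KLRegimeEngineV17F2`), class #6 under the «ISO-MOMENT ROW» cure «G10-MOM»:
# the ONE-CALL UNROLL (composition §C) and the STUB-(c) CONSUMER DOOR at the explicit constants
# (cell gate-hubbard-kl, seat hubbard-kl-k3c2-p2 g14 = class-#6 text owner; texts `…EngineV8IsoMomentRow`, `…EngineV8DefsG10`)

WHAT.  With M2 a stub-(b)ₙ row `IsoFirstMomentsAt L M klIsoMomC (klIsoMomD P R) P β U μ n`, class #6 needs no export conjunct, no deferred package and no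
induction over the scales: the B line `IsoTupleLineBAt L M klE5AM klE5cM (klE5dM P R) P β U μ j` at a scale `j` is route (M)'s producer
(`isoTupleLineBAt_of_momentLine_numeral_klEng`, p588933) read with THAT scale's row (`j ≥ 1`) or the landed scale-0 line (`j = 0`) — the producer needs
the row, the admissibility of `K_j` and the v2 thresholds ONLY.
* §1 `isoTupleLineBAt_of_isoFirstMomentsAt` (generic constants `(2⁹, 2¹⁷cM, 2¹⁷cM′)`), `isoTupleLineBAt_klE5M_of_row` (`j ≥ 1`), `isoTupleLineBAt_klE5M_zero`
  (`j = 0`), `isoTupleLineBAt_klE5M_at` (any `j`, row asked only when `1 ≤ j`), and **`isoTupleLineBAt_klE5M_all`**: under the composition's binders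
  (`R.WF2`, bare frame admissible, history up to `n ≤ n_β + 1` — for `FrameOK K_j` — and the rows at every `1 ≤ m ≤ n`), `∀ j ≤ n, IsoTupleLineBAt L M klE5AM
  klE5cM (klE5dM P R) P β U μ j` — stub (c)'s `hiso` binder in ONE call.
* §2 **`isoTupleL1AtV17F_of_klE5M_hist`** — stub (c)'s (E5-F)ₙ from the explicit B line: `klEngGeo8.CF + klE5CFM ≤ G.CF` (e.g. `G = klEngGeo10`),
  `U ≤ klE5uM P R` and the W/B door's residual inputs verbatim (history, the CURRENT (E2″-F)ₙ, two bare-ball points with `4⁻¹ < |q + q₃|_𝕋`,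
  `R.Gfr 0·|U| ≤ klE0/32`, accumulated rows `≤ U/2`); `…_klEngGeo10` instance.
* §3 for the record, the frozen B-text objects PROVED from the row at a G-KEYED step: `isoTupleLineBAt_klE5M_of_rows_hist` is all the composition
  needs; no `IsoTupleLineStepB` instance is derivable (its `∀ G` body has G-blind constants — finding «(X).2-B-∀G»), and none is needed.
Inequalities between landed predicates; nothing about the model is asserted; nothing asserts superconductivity.
-/

noncomputable section

namespace Summit.HubbardSuperconductivity.HubbardSuperconductivity.Theorems.KLRegimeSplit

set_option linter.dupNamespace false -- summit = problem name (single-conjunct summit), D-0017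

open Real Finset Literature.MathematicalPhysics.QuantumLattice Literature.Probability.LatticeModels
open Summit.HubbardSuperconductivity.HubbardSuperconductivity.Theorems.KLProgrammeLegKernels
open Summit.HubbardSuperconductivity.HubbardSuperconductivity.Theorems.DispersionFlow
open Summit.HubbardSuperconductivity.HubbardSuperconductivity.Theorems.EngineV8

/-! ## §1 The B line at one scale from that scale's row; the one-call unroll -/

section Unroll

variable {L M : ℕ} [NeZero L] [NeZero M]

/-- **Row ⇒ B line, generic constants** (`1 ≤ n`, v2 doors): `IsoFirstMomentsAt L M cM cM′ … n` (`cM, cM′ ≥ 0`) ⟹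
`IsoTupleLineBAt L M 2⁹ (2¹⁷cM) (2¹⁷cM′) … n` — route (M)'s producer read with the row. -/
theorem isoTupleLineBAt_of_isoFirstMomentsAt (P : SplitConsts) (R : RenConsts) (cc : ℝ) (hR2 : R.WF2) (hcc : 0 < cc) (hcc6 : cc ≤ klEngC₃6 P R)
    {μ : ℝ} (hμ : μ ∈ klWindowC) {U : ℝ} (hU : 0 < U) (hU10 : U ≤ klEngU₀10 P R cc) {β : ℝ} (hβmin : klBetaMin ≤ β) (hβc : β ≤ Real.exp (cc / U ^ 2))
    (hL : klEngL₄ P R β U ≤ L) (hM : klEngM₃ β U L ≤ M) {n : ℕ} (hn1 : 1 ≤ n) (hK : FrameOK R U (nScales β) μ (klFlowFrameU L M β U μ n))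
    {cM cM' : ℝ} (hcM : 0 ≤ cM) (hcM' : 0 ≤ cM') (hrow : IsoFirstMomentsAt L M cM cM' P β U μ n) :
    IsoTupleLineBAt L M (2 ^ 9) (2 ^ 17 * cM) (2 ^ 17 * cM') P β U μ n :=
  isoTupleLineBAt_of_momentLine_numeral_klEng P R cc hR2 hcc hcc6 hμ hU hU10 hβmin hβc hL hM hn1 hK hcM hcM' (hrow.hmom hU.le)

/-- **Row at the deferred constants ⇒ the explicit class-#6 B line** (`1 ≤ n`, v2 doors):
`IsoFirstMomentsAt L M klIsoMomC (klIsoMomD P R) … n ⟹ IsoTupleLineBAt L M klE5AM klE5cM (klE5dM P R) … n`. -/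
theorem isoTupleLineBAt_klE5M_of_row (P : SplitConsts) (R : RenConsts) (cc : ℝ) (hR2 : R.WF2) (hcc : 0 < cc) (hcc6 : cc ≤ klEngC₃6 P R)
    {μ : ℝ} (hμ : μ ∈ klWindowC) {U : ℝ} (hU : 0 < U) (hU10 : U ≤ klEngU₀10 P R cc) {β : ℝ} (hβmin : klBetaMin ≤ β) (hβc : β ≤ Real.exp (cc / U ^ 2))
    (hL : klEngL₄ P R β U ≤ L) (hM : klEngM₃ β U L ≤ M) {n : ℕ} (hn1 : 1 ≤ n) (hK : FrameOK R U (nScales β) μ (klFlowFrameU L M β U μ n))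
    (hrow : IsoFirstMomentsAt L M klIsoMomC (klIsoMomD P R) P β U μ n) :
    IsoTupleLineBAt L M klE5AM klE5cM (klE5dM P R) P β U μ n :=
  (isoTupleLineBAt_of_isoFirstMomentsAt P R cc hR2 hcc hcc6 hμ hU hU10 hβmin hβc hL hM hn1 hK klIsoMomC_nonneg (klIsoMomD_nonneg P R) hrow).mono
    hU.le (le_of_eq klE5AM_eq.symm) klE5cM_ge_mom (klE5dM_ge_mom P R)

/-- **The explicit class-#6 B line at scale `0`** (the landed scale-0 line `(0, klIsoT⁴/2, klIsoT⁴·klScaleZeroValC R/192)`, v2 doors). -/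
theorem isoTupleLineBAt_klE5M_zero (P : SplitConsts) (R : RenConsts) (hP : P.WF) (hR : R.WF2) {cc : ℝ} (hcc : 0 < cc) (hcc6 : cc ≤ klEngC₃6 P R)
    {μ : ℝ} (hμ : μ ∈ klWindowC) {U : ℝ} (hU : 0 < U) (hU10 : U ≤ klEngU₀10 P R cc) {β : ℝ} (hβ : klBetaMin ≤ β) (hβc : β ≤ Real.exp (cc / U ^ 2))
    (hL : klEngL₄ P R β U ≤ L) (hM : klEngM₃ β U L ≤ M) (hK : FrameOK R U (nScales β) μ (klFlowFrameU L M β U μ 0)) :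
    IsoTupleLineBAt L M klE5AM klE5cM (klE5dM P R) P β U μ 0 :=
  (isoTupleLineBAt_scaleZero P R hP hR hcc hcc6 hμ hU hU10 hβ hβc hL hM hK).mono hU.le klE5AM_nonneg klE5cM_ge_zero_line (klE5dM_ge_zero_line P R)

/-- **The explicit class-#6 B line at any scale `n`** from `FrameOK K_n` and the row WHEN `1 ≤ n` (v2 doors). -/
theorem isoTupleLineBAt_klE5M_at (P : SplitConsts) (R : RenConsts) (hP : P.WF) (hR : R.WF2) {cc : ℝ} (hcc : 0 < cc) (hcc6 : cc ≤ klEngC₃6 P R)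
    {μ : ℝ} (hμ : μ ∈ klWindowC) {U : ℝ} (hU : 0 < U) (hU10 : U ≤ klEngU₀10 P R cc) {β : ℝ} (hβ : klBetaMin ≤ β) (hβc : β ≤ Real.exp (cc / U ^ 2))
    (hL : klEngL₄ P R β U ≤ L) (hM : klEngM₃ β U L ≤ M) {n : ℕ} (hK : FrameOK R U (nScales β) μ (klFlowFrameU L M β U μ n))
    (hrow : 1 ≤ n → IsoFirstMomentsAt L M klIsoMomC (klIsoMomD P R) P β U μ n) :
    IsoTupleLineBAt L M klE5AM klE5cM (klE5dM P R) P β U μ n := by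
  rcases Nat.eq_zero_or_pos n with rfl | hn1
  · exact isoTupleLineBAt_klE5M_zero P R hP hR hcc hcc6 hμ hU hU10 hβ hβc hL hM hK
  · exact isoTupleLineBAt_klE5M_of_row P R cc hR hcc hcc6 hμ hU hU10 hβ hβc hL hM hn1 hK (hrow hn1)

/-- **CLASS #6 UNROLLED IN ONE CALL (composition §C's `hiso`)**: under the v2 binders, `R.WF2`, the bare frame's admissibility and the public history up to
`n ≤ n_β + 1` at `G P Q R` (only to certify `FrameOK K_j` at every `j ≤ n`), the rows `IsoFirstMomentsAt L M klIsoMomC (klIsoMomD P R) P β U μ m` at every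
`1 ≤ m ≤ n` (stub (b)ₘ's new conjunct) give the explicit B line at EVERY `j ≤ n`.  No induction over `j`, no class-#1 data, no `KernelNormsV4`. -/
theorem isoTupleLineBAt_klE5M_all {G : GeoConsts} {P : SplitConsts} {Q : EngConsts} {R : RenConsts} (hP : P.WF) (hR : R.WF2) {cc : ℝ} (hcc : 0 < cc)
    (hcc6 : cc ≤ klEngC₃6 P R) {μ : ℝ} (hμ : μ ∈ klWindowC) {U β : ℝ} (h0 : FrameOK R U (nScales β) μ 0) (hU : 0 < U) (hU10 : U ≤ klEngU₀10 P R cc)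
    (hβ : klBetaMin ≤ β) (hβc : β ≤ Real.exp (cc / U ^ 2)) (hL : klEngL₄ P R β U ≤ L) (hM : klEngM₃ β U L ≤ M) {n : ℕ} (hn : n ≤ nScales β + 1)
    (hhist : HistP klPredsV17F2 L M G P Q R β U μ 0 n)
    (hrows : ∀ m : ℕ, 1 ≤ m → m ≤ n → IsoFirstMomentsAt L M klIsoMomC (klIsoMomD P R) P β U μ m) :
    ∀ j ≤ n, IsoTupleLineBAt L M klE5AM klE5cM (klE5dM P R) P β U μ j := by
  intro j hj
  have hjn : j ≤ nScales β + 1 := hj.trans hn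
  have hhj : HistP klPredsV17F2 L M G P Q R β U μ 0 j := histP_klPredsV17F2_of_le hhist hj
  have hKj : FrameOK R U (nScales β) μ (klFlowFrameU L M β U μ j) := frameOK_klFlowFrameU_of_histP hR h0 hjn hhj
  exact isoTupleLineBAt_klE5M_at P R hP hR hcc hcc6 hμ hU hU10 hβ hβc hL hM hKj (fun hj1 => hrows j hj1 hj)

/-- The same with the rows given as a function of `FrameOK K_m` (for a composition that derives each row from stub (b)ₘ on the spot). -/
theorem isoTupleLineBAt_klE5M_all_of_frame {G : GeoConsts} {P : SplitConsts} {Q : EngConsts} {R : RenConsts} (hP : P.WF) (hR : R.WF2) {cc : ℝ}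
    (hcc : 0 < cc) (hcc6 : cc ≤ klEngC₃6 P R) {μ : ℝ} (hμ : μ ∈ klWindowC) {U β : ℝ} (h0 : FrameOK R U (nScales β) μ 0) (hU : 0 < U)
    (hU10 : U ≤ klEngU₀10 P R cc) (hβ : klBetaMin ≤ β) (hβc : β ≤ Real.exp (cc / U ^ 2)) (hL : klEngL₄ P R β U ≤ L) (hM : klEngM₃ β U L ≤ M)
    {n : ℕ} (hn : n ≤ nScales β + 1) (hhist : HistP klPredsV17F2 L M G P Q R β U μ 0 n)
    (hrows : ∀ m : ℕ, 1 ≤ m → m ≤ n → HistP klPredsV17F2 L M G P Q R β U μ 0 m → FrameOK R U (nScales β) μ (klFlowFrameU L M β U μ m) →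
      IsoFirstMomentsAt L M klIsoMomC (klIsoMomD P R) P β U μ m) :
    ∀ j ≤ n, IsoTupleLineBAt L M klE5AM klE5cM (klE5dM P R) P β U μ j :=
  isoTupleLineBAt_klE5M_all hP hR hcc hcc6 hμ h0 hU hU10 hβ hβc hL hM hn hhist fun m hm1 hmn =>
    hrows m hm1 hmn (histP_klPredsV17F2_of_le hhist hmn) (frameOK_klFlowFrameU_of_histP hR h0 (hmn.trans hn) (histP_klPredsV17F2_of_le hhist hmn))

end Unroll

/-! ## §2 The stub-(c) consumer door at the explicit constants -/

section Consumer

variable {L M : ℕ} [NeZero L] [NeZero M]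

/-- **(E5-F)ₙ from the explicit class-#6 B line** (`1 ≤ n ≤ n_β + 1`): the stub-(c) binder `hiso` at `j = n`, a package with
`klEngGeo8.CF + klE5CFM ≤ G.CF` (e.g. `klEngGeo10`), the threshold `U ≤ klE5uM P R` (DefsU entry), and the W/B door's residual inputs verbatim (history, the
CURRENT (E2″-F)ₙ, two bare-ball points with `4⁻¹ < |q + q₃|_𝕋`, `R.Gfr 0·|U| ≤ klE0/32`, accumulated rows `≤ U/2`) ⟹ `IsoTupleL1AtV17F L M G P β U μ n`. -/
theorem isoTupleL1AtV17F_of_klE5M_hist {G : GeoConsts} {P : SplitConsts} {Q : EngConsts} {R : RenConsts} {β U μ : ℝ}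
    (hG : G.WF) (hP : P.WF) (hQ : Q.WF) (hR : R.WF2) (hU : 0 < U) (hGCF : klEngGeo8.CF + klE5CFM ≤ G.CF) {n : ℕ} (hn1 : 1 ≤ n) (hn : n ≤ nScales β + 1)
    (hUu : U ≤ klE5uM P R)
    (hline : IsoTupleLineBAt L M klE5AM klE5cM (klE5dM P R) P β U μ n)
    (hhist : HistP klPredsV17F2 L M G P Q R β U μ 0 n) (hE2'' : PairValueIncrementAtV17F L M G P Q β U μ n)
    {q q₃ : TorusSite 2 L} (hq : q ∈ klBall L μ 0) (hq₃ : q₃ ∈ klBall L μ 0) (hqq : 4⁻¹ < klTorusNorm L (q + q₃))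
    (hUκ : R.Gfr 0 * |U| ≤ 1 / 32 * klE0)
    (hsmall : initDevBar G U + legDressBarQ2 G P Q U 0 4 +
        (3 * G.CF * (P.Klam * U) ^ 2 +
          ((G.cloc * P.Klam ^ 2 * (1 - (4 : ℝ) ^ (-G.θ))⁻¹ + 2 * Q.CR * P.Klam ^ 3 * |U|) * U ^ 2 + ∑ j ∈ range n, Q.CL β j / L) +
            7 / 3 * (G.CF * (P.Klam * U) ^ 2) + 20 * (Q.CR * ((P.Klam * U) ^ 2 + (P.Klam * |U|) ^ 3)) +
              4 / 3 * (Q.CR * (P.Klam * U) ^ 2)) ≤ U / 2) :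
    IsoTupleL1AtV17F L M G P β U μ n :=
  isoTupleL1AtV17F_of_isoTupleLineBAt_hist hG hP hQ hR.wf hU hn1 hn klE5cM_nonneg (klE5dM_nonneg P hR) hline (klE5M_fit hP hR hGCF hUu)
    hhist hE2'' hq hq₃ hqq hUκ hsmall

/-- **The same at the proposed package `klEngGeo10`.** -/
theorem isoTupleL1AtV17F_klEngGeo10_of_klE5M_hist {P : SplitConsts} {Q : EngConsts} {R : RenConsts} {β U μ : ℝ}
    (hP : P.WF) (hQ : Q.WF) (hR : R.WF2) (hU : 0 < U) {n : ℕ} (hn1 : 1 ≤ n) (hn : n ≤ nScales β + 1) (hUu : U ≤ klE5uM P R)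
    (hline : IsoTupleLineBAt L M klE5AM klE5cM (klE5dM P R) P β U μ n)
    (hhist : HistP klPredsV17F2 L M klEngGeo10 P Q R β U μ 0 n) (hE2'' : PairValueIncrementAtV17F L M klEngGeo10 P Q β U μ n)
    {q q₃ : TorusSite 2 L} (hq : q ∈ klBall L μ 0) (hq₃ : q₃ ∈ klBall L μ 0) (hqq : 4⁻¹ < klTorusNorm L (q + q₃))
    (hUκ : R.Gfr 0 * |U| ≤ 1 / 32 * klE0)
    (hsmall : initDevBar klEngGeo10 U + legDressBarQ2 klEngGeo10 P Q U 0 4 +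
        (3 * klEngGeo10.CF * (P.Klam * U) ^ 2 +
          ((klEngGeo10.cloc * P.Klam ^ 2 * (1 - (4 : ℝ) ^ (-klEngGeo10.θ))⁻¹ + 2 * Q.CR * P.Klam ^ 3 * |U|) * U ^ 2 +
            ∑ j ∈ range n, Q.CL β j / L) +
            7 / 3 * (klEngGeo10.CF * (P.Klam * U) ^ 2) + 20 * (Q.CR * ((P.Klam * U) ^ 2 + (P.Klam * |U|) ^ 3)) +
              4 / 3 * (Q.CR * (P.Klam * U) ^ 2)) ≤ U / 2) :
    IsoTupleL1AtV17F L M klEngGeo10 P β U μ n :=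
  isoTupleL1AtV17F_of_klE5M_hist klEngGeo10_wf hP hQ hR hU klEngGeo8_CF_add_klE5CFM_le_klEngGeo10_CF hn1 hn hUu hline hhist hE2'' hq hq₃ hqq hUκ hsmall

end Consumer

end Summit.HubbardSuperconductivity.HubbardSuperconductivity.Theorems.KLRegimeSplit

end
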